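import Literature.NumberTheory.LFunctions.Zhang2022.KnifeEdgeLenZDegreeK0Piece
import Literature.NumberTheory.LFunctions.Zhang2022.KnifeEdgeLenZDegreeK0Polar
import Literature.NumberTheory.LFunctions.Zhang2022.KnifeEdgeEndgameClosed

/-!
# Zhang (2022), rung F-S3 (Landau–Siegel programme, §D CHAIN #1, crux K0 = stmt-Parity-20016): the repaired side table
# on SHORT in-class pieces REDUCED IN THE KERNEL to the one §8 row (S) «`α⁻¹S_j(χu, χū) = 𝔪_j(u)·𝔞 + o(𝔞)`»

Y. Zhang, *Discrete mean estimates and the Landau–Siegel zero*, arXiv:2211.02515v1 [Zhang2022LandauSiegel] — an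
unrefereed manuscript under adjudication. **WHAT THIS IS NOT: not a claim about Theorems 1–2 of arXiv:2211.02515, about
Landau–Siegel zeros, or about Parity. The programme SEARCHES and TYPES; no claim about Landau–Siegel zeros, Theorems 1–2 of
arXiv:2211.02515 or a repaired Margin232 until a kernel theorem says so. `SjProfileRow` and `InClassMeanShort` are bare
`Prop`s (statement SHAPES, asserted by no one); the theorems are implications on top of TREE THEOREMS (Prop. 7.1
`prop71X_holds`, Lemma 8.1 / Prop. 2.2 (i) / Lemma 2.3 eventually, the Part-8 entry `discMean_apoly_of_meanValue_closed'`
of `KnifeEdgeEndgameClosed`, and DISPLAY #5's dictionary `KnifeEdgeLenZDegreeK0Polar`, p533892).**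

## What this file does (prover ls-knife-K0-p1 g0; memo `K0-MISSTATED.md`; companion `KnifeEdgeLenZDegreeK0Piece`)

The repaired K0 is `InClassMeanPiece c′` (the side table on `InClassPiece` profiles). Its (7.2)-clean first rung is the
same table on SHORT in-class pieces — `u = 0` on `[θ,∞)` for some `θ < 1` — for which the coefficient table
`n ↦ χ(n)u(log n/log P)` IS (7.2)-admissible (support below `P^θ < PT⁻²` eventually; `profTable`, `adm72_profTable`,
`apoly_profTable_eq_profPoly`), so that the manuscript's own mean-value nodes apply VERBATIM: Lemma 8.1 + Prop. 7.1
(both tree theorems) say `Ξ(H_u) = 2Re Θ₁(𝐚,𝐚̄) + o(𝔓)`, `Θ₁ = α⁻¹(½S₁ + 2S₂ + 3/2·S₃)𝔓 + O(E) + o(𝔓)`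
(`discMean_apoly_of_meanValue_closed'`, p-ids in `KnifeEdgeEndgameClosed` Part 8). What is then LEFT of K0 on short
pieces is exactly the evaluation of the three arithmetic sums `S_j(𝐚,𝐚̄)` for PROFILE data — DISPLAY #5 §2's row

  (S)  `α⁻¹·S_j(χu, χū) = 𝔪_j(u)·𝔞 + o(𝔞)`,  `𝔪_j(u) := −(1/π)∫₀¹ 𝔧_j(u;z)·𝔪(bS j, bN j; ū)(z) dz`

(`𝔧_j` = LEMMA A's jet `k0jet`, `𝔪` = LEMMA A*'s mass rule `k0mass`, p533892) — typed here as `SjProfileRow c′ j u u′`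
(OPEN; the §8 number theory: Lemmas 8.2/8.4 for general in-class profiles + the gathering (8.10)–(8.12)). This file
PROVES: (S) for `j = 1,2,3` ⇒ the (M) row with constant `Mform(u,u) + conj = K0polar(u,u) = 𝔅(u)` (p533892
`k0polar_self_eq_mainTermForm`, using `u 1 = 0`) and the (E) row (`E = 𝔓𝓛²Σ|S_j| ≤ π(Σ|𝔪_j|+3)·𝓛⁻⁷·𝔞𝔓 = o(𝔞𝔓)`), hence
`inClassMean_short_of_sjRows`: **for every sufficiently large `c′`, the three rows (S) for a short in-class piece `u` give
K0's asymptotic for `u`** — and packaged, `inClassMeanShort_of_sjRows : (rows (S) on all short pieces) → InClassMeanShort c′`.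

## References
* Y. Zhang, arXiv:2211.02515v1 (2022), §7 Prop 7.1 (7.2), p. 13; §8 Lemma 8.1, (8.3), (8.10)–(8.12), (8.23).
  [cite: Zhang2022LandauSiegel, §7 Prop 7.1 (7.2); §8 (8.10)–(8.23)]
-/

noncomputable section

open Complex Real ComplexConjugate Set MeasureTheory intervalIntegral

namespace Literature.NumberTheory.LFunctions.Zhang2022

namespace KnifeEdge

open Repair Skeleton

/-! ### Part 1 — the profile coefficient table and its (7.2)-admissibility -/

section Table

/-- **The coefficient table of a profile piece**: `𝐚_u(n) = χ(n)·u(log n/log P)` for `n < ⌈PT⁻²⌉` (the (7.2) support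
`Skeleton.Nsupp`), `0` beyond — so that `A(𝐚_u; s, ψ) = Σ_{n<⌈PT⁻²⌉} χψ(n)u(z_n)n^{−s}` is the manuscript's Dirichlet
polynomial of the piece. [cite: Zhang2022LandauSiegel, §7 (7.2), p. 13] -/
def profTable (u : ℝ → ℂ) (D : ℕ) (χ : DirichletCharacter ℂ D) (n : ℕ) : ℂ :=
  if n < Nsupp D then χ (n : ZMod D) * u (Real.log n / Real.log (bigP D)) else 0

/-- The logarithmic position `log n/log P` is `≥ 0`. [cite: Zhang2022LandauSiegel, §2 (2.23)] -/
private theorem logPos_nonneg (D n : ℕ) : 0 ≤ Real.log n / Real.log (bigP D) := by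
  apply div_nonneg (Real.log_natCast_nonneg n)
  rw [bigP, Real.log_exp]
  exact pow_nonneg (Real.log_natCast_nonneg D) 9

/-- An in-class piece is bounded on `[0,∞)`: `‖u z‖ ≤ B` for all `z ≥ 0`, some `B ≥ 0` (continuous on `[0,1]`, zero
beyond). [cite: Zhang2022LandauSiegel, §7 (7.2)] -/
theorem InClassPiece.exists_bound {u u' : ℝ → ℂ} (hu : InClassPiece u u') :
    ∃ B : ℝ, 0 ≤ B ∧ ∀ z : ℝ, 0 ≤ z → ‖u z‖ ≤ B := by
  obtain ⟨B, hB⟩ := isCompact_Icc.exists_bound_of_continuousOn hu.kinked.cont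
  refine ⟨max B 0, le_max_right _ _, fun z hz => ?_⟩
  by_cases h1 : z ≤ 1
  · exact (hB z ⟨hz, h1⟩).trans (le_max_left _ _)
  · rw [hu.vanish z (le_of_lt (not_le.mp h1)), norm_zero]
    exact le_max_right _ _

/-- **(7.2)-admissibility of the profile table at EVERY modulus:** `|𝐚_u(n)| ≤ B` and `𝐚_u(n) = 0` for `n ≥ PT⁻²`.
[cite: Zhang2022LandauSiegel, §7 (7.2)] -/
theorem adm72_profTable {u : ℝ → ℂ} {B : ℝ} (hB0 : 0 ≤ B) (hB : ∀ z : ℝ, 0 ≤ z → ‖u z‖ ≤ B) (D : ℕ)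
    (χ : DirichletCharacter ℂ D) : Adm72 D B (profTable u D χ) := by
  constructor
  · intro n
    unfold profTable
    split_ifs with h
    · calc ‖χ (n : ZMod D) * u (Real.log n / Real.log (bigP D))‖
          = ‖χ (n : ZMod D)‖ * ‖u (Real.log n / Real.log (bigP D))‖ := norm_mul _ _
        _ ≤ 1 * B := mul_le_mul (χ.norm_le_one _) (hB _ (logPos_nonneg D n)) (norm_nonneg _) zero_le_one
        _ = B := one_mul B
    · rw [norm_zero]; exact hB0
  · intro n hn
    unfold profTable
    rw [if_neg]
    exact not_lt.mpr (Nat.ceil_le.mpr hn)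

end Table

/-! ### Part 2 — for a SHORT piece the table's polynomial is the profile polynomial of length `P`, eventually -/

section Short

/-- `⌈exp L₀⌉ ≤ D` gives `L₀ ≤ 𝓛`. [folklore] -/
private theorem le_ell_of_ceil_exp_le {L₀ : ℝ} {D : ℕ} (hD : ⌈Real.exp L₀⌉₊ ≤ D) : L₀ ≤ ell D := by
  have h : Real.exp L₀ ≤ (D : ℝ) := (Nat.le_ceil _).trans (by exact_mod_cast hD)
  exact (Real.le_log_iff_exp_le (lt_of_lt_of_le (Real.exp_pos _) h)).mpr h

/-- `log P = 𝓛⁹`. [cite: Zhang2022LandauSiegel, §2 (2.6)] -/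
private theorem log_bigP (D : ℕ) : Real.log (bigP D) = ell D ^ 9 := by rw [bigP, Real.log_exp]

/-- **The support comparison `P^θ ≤ PT⁻²` for large `D`** (`θ < 1`): if `𝓛 ≥ 1` and `𝓛 ≥ 2/(1−θ)` then
`P^θ ≤ P/T²`. [cite: Zhang2022LandauSiegel, §6 p. 12, §7 (7.2)] -/
private theorem rpow_le_div_T_sq {θ : ℝ} {D : ℕ} (hθ : θ < 1) (hL1 : 1 ≤ ell D) (hL : 2 / (1 - θ) ≤ ell D) :
    bigP D ^ θ ≤ bigP D / bigT D ^ 2 := by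
  have hP : 0 < bigP D := Real.exp_pos _
  have h1θ : 0 < 1 - θ := by linarith
  -- compare logarithms: θ𝓛⁹ ≤ 𝓛⁹ − 2𝓛^{1.1}
  rw [bigP, bigT, ← Real.exp_mul, ← Real.exp_nat_mul, ← Real.exp_sub, Real.exp_le_exp]
  have hL0 : 0 < ell D := by linarith
  have h11 : ell D ^ (1.1 : ℝ) ≤ ell D ^ (2 : ℝ) :=
    Real.rpow_le_rpow_of_exponent_le hL1 (by norm_num)
  have h2 : ell D ^ (2 : ℝ) = ell D ^ 2 := by norm_cast
  have h29 : ell D ^ 2 * ell D ≤ ell D ^ 9 := by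
    have : ell D ^ 2 * ell D = ell D ^ 3 := by ring
    rw [this]
    exact pow_le_pow_right₀ hL1 (by norm_num)
  have hkey : 2 * ell D ^ 2 ≤ (1 - θ) * ell D ^ 9 := by
    have h3 : 2 ≤ (1 - θ) * ell D := by rwa [div_le_iff₀ h1θ, mul_comm] at hL
    nlinarith [pow_nonneg hL0.le 2]
  have hexp : (1 - θ) * ell D ^ 9 = ell D ^ 9 - ell D ^ 9 * θ := by ring
  rw [h2] at h11
  push_cast
  linarith

/-- **For a short piece the (7.2)-table's polynomial IS the profile polynomial of length `P`**, eventually in `D`: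
`A(𝐚_u; s, ψ) = Σ_{1≤n≤⌊P⌋} χψ(n)u(z_n)n^{−s}` for every member `ψ` of `Ψ` and every `s` (the terms with
`⌈PT⁻²⌉ ≤ n ≤ P` vanish because `z_n ≥ θ`). [cite: Zhang2022LandauSiegel, §7 (7.2), §2 (2.23)] -/
theorem apoly_profTable_eq_profPoly {u : ℝ → ℂ} {θ : ℝ} (hθ : θ < 1) (hvan : ∀ y : ℝ, θ ≤ y → u y = 0) :
    ForAllLarge fun D _ χ => ∀ (x : Chr D) (s : ℂ),
      Apoly x (profTable u D χ) s = profPoly χ x u (⌊bigP D⌋₊ + 1) s := by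
  refine ForAllLarge.of_le (max 3 ⌈Real.exp (max 1 (2 / (1 - θ)))⌉₊) fun D _ χ hD _ _ x s => ?_
  have hD3 : 3 ≤ D := le_trans (le_max_left _ _) hD
  have hL : max 1 (2 / (1 - θ)) ≤ ell D := le_ell_of_ceil_exp_le (le_trans (le_max_right _ _) hD)
  have hL1 : 1 ≤ ell D := le_trans (le_max_left _ _) hL
  have hL2 : 2 / (1 - θ) ≤ ell D := le_trans (le_max_right _ _) hL
  have hP : 0 < bigP D := Real.exp_pos _
  have hlogP : 0 < Real.log (bigP D) := by rw [log_bigP]; positivity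
  have hT1 : 1 ≤ bigT D := Real.one_le_exp (by unfold ell; positivity)
  have hsupp : bigP D ^ θ ≤ bigP D / bigT D ^ 2 := rpow_le_div_T_sq hθ hL1 hL2
  -- `Nsupp ≤ ⌊P⌋ + 1`
  have hN : Nsupp D ≤ ⌊bigP D⌋₊ + 1 := by
    unfold Nsupp
    have h1 : bigP D / bigT D ^ 2 ≤ bigP D := div_le_self hP.le (one_le_pow₀ hT1)
    calc ⌈bigP D / bigT D ^ 2⌉₊ ≤ ⌈bigP D⌉₊ := Nat.ceil_le_ceil h1
      _ ≤ ⌊bigP D⌋₊ + 1 := Nat.ceil_le_floor_add_one _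
  -- coefficients vanish from `Nsupp` on
  have hzero : ∀ n : ℕ, Nsupp D ≤ n → u (Real.log n / Real.log (bigP D)) = 0 := by
    intro n hn
    apply hvan
    have hn' : bigP D / bigT D ^ 2 ≤ n := Nat.ceil_le.mp hn
    have hnθ : bigP D ^ θ ≤ n := hsupp.trans hn'
    have hn0 : (0 : ℝ) < n := lt_of_lt_of_le (Real.rpow_pos_of_pos hP θ) hnθ
    rw [le_div_iff₀ hlogP, ← Real.log_rpow hP]
    exact Real.log_le_log (Real.rpow_pos_of_pos hP θ) hnθ
  -- split both sums at `Nsupp`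
  have hN1 : 1 ≤ Nsupp D := Nat.one_le_iff_ne_zero.mpr
    (Nat.pos_iff_ne_zero.mp (Nat.ceil_pos.mpr (div_pos hP (by positivity))))
  have hL : Apoly x (profTable u D χ) s
      = ∑ n ∈ Finset.Ico 1 (Nsupp D), profTable u D χ n * x.ψ (n : ZMod x.p) * (n : ℂ) ^ (-s) := by
    unfold Apoly Lemma81.dirPoly
    rw [Finset.range_eq_Ico, Finset.sum_eq_sum_Ico_succ_bot (Nat.lt_of_lt_of_le Nat.zero_lt_one hN1)]
    simp [MulChar.map_zero x.ψ]
  have hR : profPoly χ x u (⌊bigP D⌋₊ + 1) s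
      = ∑ n ∈ Finset.Ico 1 (Nsupp D), pc χ x n * u (Real.log n / Real.log (bigP D)) * (n : ℂ) ^ (-s) := by
    unfold profPoly
    rw [← Finset.sum_Ico_consecutive _ hN1 hN]
    have htail : ∑ n ∈ Finset.Ico (Nsupp D) (⌊bigP D⌋₊ + 1),
        pc χ x n * u (Real.log n / Real.log (bigP D)) * (n : ℂ) ^ (-s) = 0 := by
      refine Finset.sum_eq_zero fun n hn => ?_
      rw [Finset.mem_Ico] at hn
      rw [hzero n hn.1, mul_zero, zero_mul]
    rw [htail, add_zero]
  rw [hL, hR]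
  refine Finset.sum_congr rfl fun n hn => ?_
  rw [Finset.mem_Ico] at hn
  unfold profTable pc
  rw [if_pos hn.2]
  ring

end Short

/-! ### Part 3 — the §8 row (S) for profile data, and the closed-form constants -/

section Rows

variable (c' : ℝ)

/-- **The main-term constant of row (S)**: `𝔪_j(u) := −(1/π)∫₀¹ 𝔧_j(u;z)·𝔪(bS j, bN j; ū)(z) dz` — LEMMA A's jet against
LEMMA A*'s mass rule of the CONJUGATE profile (the anti-side datum of K0 is `𝐚₂ = conj 𝐚₁ = χ·ū`), DISPLAY #5 §2.
[cite: Zhang2022LandauSiegel, §8 (8.10)–(8.12), Lemmas 8.2/8.4] -/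
def sjProfileMain (j : ℕ) (u u' : ℝ → ℂ) : ℂ :=
  -(((1 / π : ℝ)) : ℂ) * ∫ z in (0:ℝ)..1,
    k0jet j u u' z * k0mass (Repair.bS j) (Repair.bN j) (fun t => conj (u t)) (fun t => conj (u' t)) z

/-- **ROW (S) (shape, OPEN — the residual §8 number theory of K0; asserted by no one):** under (A), eventually in `D`,
`α⁻¹·S_j(𝐚_u, conj 𝐚_u) = 𝔪_j(u)·𝔞 + o(𝔞)` for the profile table `𝐚_u` — Zhang's (8.9)–(8.12) for a general
in-class profile in place of `ϰ₁, ϰ₂` (LEMMA A = Lemma 8.2 generalised on the `ψ`-side, LEMMA A* = Lemmas 8.3/8.4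
generalised on the anti-side, gathered by (8.10)–(8.11)). [cite: Zhang2022LandauSiegel, §8 (8.9)–(8.12), Lemmas 8.2–8.4] -/
def SjProfileRow (j : ℕ) (u u' : ℝ → ℂ) : Prop :=
  ∀ ε : ℝ, 0 < ε → ForAllLarge fun D _ χ => AssumptionA D χ →
    ‖(alpha D : ℂ)⁻¹ * Sj c' D j (profTable u D χ) (fun n => conj (profTable u D χ n))
        - sjProfileMain j u u' * frakA χ‖ ≤ ε * frakA χ

/-- **THE REPAIRED K0 ON SHORT PIECES (shape, NOT asserted):** the side-table asymptotic for every in-class piece that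
vanishes from some `θ < 1` on. (`InClassMeanPiece c′ → InClassMeanShort c′` trivially; the converse is the full-length
sliver `(PT⁻², P]`, outside Prop. 7.1's typed support.) [cite: Zhang2022LandauSiegel, §7 Prop 7.1 (7.2), §8 (8.23)] -/
def InClassMeanShort : Prop :=
  ∀ (u u' : ℝ → ℂ) (θ : ℝ), InClassPiece u u' → θ < 1 → (∀ y : ℝ, θ ≤ y → u y = 0) →
    ∀ ε : ℝ, 0 < ε → ForAllLarge fun D _ χ => AssumptionA D χ →
      |discMean c' χ (fun x t => profPoly χ x u (⌊bigP D⌋₊ + 1) t) - mainTermForm u u' * frakA χ * frakP D|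
        ≤ ε * frakA χ * frakP D

variable {c'}

/-- The repaired slot gives the short one. [cite: Zhang2022LandauSiegel, §8 (8.23)] -/
theorem inClassMeanShort_of_inClassMeanPiece (h : InClassMeanPiece c') : InClassMeanShort c' :=
  fun u u' _ hu _ _ ε hε => h u u' hu ε hε

/-- **The dictionary behind (S) ⇒ (M):** `𝔪_j(u) = (1/π)∫₀¹ dipoleIntegrand j u u′ u u′` (p533892's pointwise identity
`𝔧_j·𝔪(bS j,bN j; v̄) = −dipoleIntegrand j`). [cite: Zhang2022LandauSiegel, Prop 7.1 with (8.11)–(8.23), pp.44–50] -/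
theorem sjProfileMain_eq (j : ℕ) (u u' : ℝ → ℂ) :
    sjProfileMain j u u' = (((1 / π : ℝ)) : ℂ) * ∫ z in (0:ℝ)..1, Repair.dipoleIntegrand j u u' u u' z := by
  unfold sjProfileMain
  simp only [k0jet_mul_k0mass_eq, intervalIntegral.integral_neg]
  ring

/-- **Prop. 7.1's weights assemble the three constants into formula I:** `½𝔪₁ + 2𝔪₂ + 3/2·𝔪₃ = Mform(u,u)`.
[cite: Zhang2022LandauSiegel, §7 Prop 7.1, (8.11)–(8.12)] -/
theorem sjProfileMain_comb (u u' : ℝ → ℂ) :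
    1 / 2 * sjProfileMain 1 u u' + 2 * sjProfileMain 2 u u' + 3 / 2 * sjProfileMain 3 u u'
      = Repair.Mform u u' u u' := by
  simp only [sjProfileMain_eq]
  unfold Repair.Mform
  ring

/-- **… and symmetrised, in class, it is `𝔅(u)`:** `Mform(u,u) + conj Mform(u,u) = K0polar(u,u) = mainTermForm u u′` for
an in-class piece (`u 1 = 0`; p533892 `k0polar_self_eq_mainTermForm`). [cite: Zhang2022LandauSiegel, §8 (8.23)] -/
theorem Mform_add_conj_eq_mainTermForm {u u' : ℝ → ℂ} (hu : InClassPiece u u') :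
    Repair.Mform u u' u u' + conj (Repair.Mform u u' u u') = (mainTermForm u u' : ℂ) := by
  rw [← k0polar_self_eq_mainTermForm hu.kinked (hu.vanish 1 le_rfl)]
  rfl

end Rows

/-! ### Part 4 — (S) ⇒ the rows (M) and (E) of the Prop. 7.1 / Lemma 8.1 entry -/

section MainAndError

variable {c' : ℝ} {u u' : ℝ → ℂ}

/-- `α = π𝓛⁻⁹` ((2.10), `P = exp 𝓛⁹`). [cite: Zhang2022LandauSiegel, §2 (2.10)] -/
private theorem alpha_eq (D : ℕ) : alpha D = π / ell D ^ 9 := by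
  rw [alpha, bigP, Real.log_exp]

/-- `⌈exp L₀⌉ ≤ D` gives `L₀ ≤ 𝓛`. [folklore] -/
private theorem le_ell_of_ceil_exp_le' {L₀ : ℝ} {D : ℕ} (hD : ⌈Real.exp L₀⌉₊ ≤ D) : L₀ ≤ ell D := by
  have h : Real.exp L₀ ≤ (D : ℝ) := (Nat.le_ceil _).trans (by exact_mod_cast hD)
  exact (Real.le_log_iff_exp_le (lt_of_lt_of_le (Real.exp_pos _) h)).mpr h

/-- **(S) ⇒ (M):** the three rows (S) give the symmetrised main-term row of `discMean_apoly_of_meanValue_closed'` with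
the constant `𝔅(u) = mainTermForm u u′` — `mainMV = α⁻¹(½S₁+2S₂+3/2S₃)𝔓`, `½𝔪₁+2𝔪₂+3/2𝔪₃ = Mform(u,u)`,
`Mform + conj Mform = 𝔅(u)` in class. [cite: Zhang2022LandauSiegel, §7 Prop 7.1, §8 (8.12), (8.23)] -/
theorem mainRow_of_sjRows (hu : InClassPiece u u') (h1 : SjProfileRow c' 1 u u') (h2 : SjProfileRow c' 2 u u')
    (h3 : SjProfileRow c' 3 u u') :
    ∀ ε : ℝ, 0 < ε → ForAllLarge fun D _ χ => AssumptionA D χ →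
      ‖(mainMV c' D (profTable u D χ) (fun n => conj (profTable u D χ n))
          + conj (mainMV c' D (profTable u D χ) (fun n => conj (profTable u D χ n))))
        - (mainTermForm u u' : ℂ) * ((frakA χ * frakP D : ℝ) : ℂ)‖ ≤ ε * (frakA χ * frakP D) := by
  intro ε hε
  have hε8 : 0 < ε / 8 := by positivity
  obtain ⟨a₀, ha₀, hAlow⟩ := frakALowerBound_holds
  refine ((((h1 _ hε8).and (h2 _ hε8)).and (h3 _ hε8)).and hAlow).mono ?_
  intro D _ χ _ _ h hA
  obtain ⟨⟨⟨e1, e2⟩, e3⟩, hAD⟩ := h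
  replace e1 := e1 hA; replace e2 := e2 hA; replace e3 := e3 hA
  have hA0 : 0 ≤ frakA χ := ha₀.le.trans (hAD hA)
  have hP0 : 0 ≤ frakP D := frakP_nonneg D
  set a := profTable u D χ with ha
  set T1 := (alpha D : ℂ)⁻¹ * Sj c' D 1 a (fun n => conj (a n)) - sjProfileMain 1 u u' * frakA χ with hT1
  set T2 := (alpha D : ℂ)⁻¹ * Sj c' D 2 a (fun n => conj (a n)) - sjProfileMain 2 u u' * frakA χ with hT2
  set T3 := (alpha D : ℂ)⁻¹ * Sj c' D 3 a (fun n => conj (a n)) - sjProfileMain 3 u u' * frakA χ with hT3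
  -- `mainMV − Mform·𝔞𝔓 = (½T₁ + 2T₂ + 3/2T₃)·𝔓`
  have hM : mainMV c' D a (fun n => conj (a n)) - Repair.Mform u u' u u' * frakA χ * frakP D
      = (1 / 2 * T1 + 2 * T2 + 3 / 2 * T3) * frakP D := by
    rw [← sjProfileMain_comb]
    unfold mainMV
    rw [hT1, hT2, hT3]
    ring
  have hTn : ‖1 / 2 * T1 + 2 * T2 + 3 / 2 * T3‖ ≤ 4 * (ε / 8 * frakA χ) := by
    calc ‖1 / 2 * T1 + 2 * T2 + 3 / 2 * T3‖
        ≤ ‖1 / 2 * T1‖ + ‖2 * T2‖ + ‖3 / 2 * T3‖ := norm_add₃_le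
      _ = 1 / 2 * ‖T1‖ + 2 * ‖T2‖ + 3 / 2 * ‖T3‖ := by
          simp only [norm_mul]
          norm_num
      _ ≤ 1 / 2 * (ε / 8 * frakA χ) + 2 * (ε / 8 * frakA χ) + 3 / 2 * (ε / 8 * frakA χ) := by
          gcongr
      _ = 4 * (ε / 8 * frakA χ) := by ring
  have hdiff : ‖mainMV c' D a (fun n => conj (a n)) - Repair.Mform u u' u u' * frakA χ * frakP D‖
      ≤ ε / 2 * (frakA χ * frakP D) := by
    rw [hM, norm_mul, Complex.norm_real, Real.norm_eq_abs, abs_of_nonneg hP0]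
    calc ‖1 / 2 * T1 + 2 * T2 + 3 / 2 * T3‖ * frakP D ≤ 4 * (ε / 8 * frakA χ) * frakP D :=
          mul_le_mul_of_nonneg_right hTn hP0
      _ = ε / 2 * (frakA χ * frakP D) := by ring
  -- symmetrise
  set Mv := mainMV c' D a (fun n => conj (a n)) with hMv
  set F := Repair.Mform u u' u u' with hF
  have hkey : (Mv + conj Mv) - (mainTermForm u u' : ℂ) * ((frakA χ * frakP D : ℝ) : ℂ)
      = (Mv - F * frakA χ * frakP D) + conj (Mv - F * frakA χ * frakP D) := by
    rw [← Mform_add_conj_eq_mainTermForm hu]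
    simp only [map_sub, map_mul, Complex.conj_ofReal]
    push_cast
    ring
  rw [hkey]
  calc ‖(Mv - F * frakA χ * frakP D) + conj (Mv - F * frakA χ * frakP D)‖
      ≤ ‖Mv - F * frakA χ * frakP D‖ + ‖conj (Mv - F * frakA χ * frakP D)‖ := norm_add_le _ _
    _ = ‖Mv - F * frakA χ * frakP D‖ + ‖Mv - F * frakA χ * frakP D‖ := by rw [Complex.norm_conj]
    _ ≤ ε / 2 * (frakA χ * frakP D) + ε / 2 * (frakA χ * frakP D) := add_le_add hdiff hdiff
    _ = ε * (frakA χ * frakP D) := by ring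

/-- From a row (S): `|S_j| ≤ α·(|𝔪_j| + 1)·𝔞` eventually under (A) (take `ε = 1`). [cite: Zhang2022LandauSiegel, §7 Prop 7.1] -/
private theorem norm_Sj_le_of_row {j : ℕ} (h : SjProfileRow c' j u u') :
    ForAllLarge fun D _ χ => AssumptionA D χ →
      ‖Sj c' D j (profTable u D χ) (fun n => conj (profTable u D χ n))‖
        ≤ alpha D * ((‖sjProfileMain j u u'‖ + 1) * frakA χ) := by
  obtain ⟨a₀, ha₀, hAlow⟩ := frakALowerBound_holds
  have h3 : ForAllLarge fun D _ _ => 3 ≤ D := ForAllLarge.of_le 3 fun D _ _ hD _ _ => hD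
  refine (((h 1 one_pos).and hAlow).and h3).mono ?_
  intro D _ χ _ _ hh hA
  obtain ⟨⟨h1, hAD⟩, hD3⟩ := hh
  replace h1 := h1 hA
  have hA0 : 0 ≤ frakA χ := ha₀.le.trans (hAD hA)
  have hα : 0 < alpha D := by
    rw [alpha_eq]
    have : (3 : ℝ) ≤ D := by exact_mod_cast hD3
    have hℓ : 0 < ell D := by
      unfold ell
      exact Real.log_pos (by linarith)
    positivity
  set S := Sj c' D j (profTable u D χ) (fun n => conj (profTable u D χ n)) with hS
  set m := sjProfileMain j u u' with hm
  have hmA : ‖m * (frakA χ : ℂ)‖ = ‖m‖ * frakA χ := by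
    rw [norm_mul, Complex.norm_real, Real.norm_eq_abs, abs_of_nonneg hA0]
  have hαS : ‖(alpha D : ℂ)⁻¹ * S‖ ≤ (‖m‖ + 1) * frakA χ := by
    have hsplit : (alpha D : ℂ)⁻¹ * S = ((alpha D : ℂ)⁻¹ * S - m * frakA χ) + m * frakA χ := by ring
    calc ‖(alpha D : ℂ)⁻¹ * S‖ = ‖((alpha D : ℂ)⁻¹ * S - m * frakA χ) + m * frakA χ‖ := by rw [← hsplit]
      _ ≤ ‖(alpha D : ℂ)⁻¹ * S - m * frakA χ‖ + ‖m * (frakA χ : ℂ)‖ := norm_add_le _ _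
      _ ≤ 1 * frakA χ + ‖m‖ * frakA χ := add_le_add h1 hmA.le
      _ = (‖m‖ + 1) * frakA χ := by ring
  have hnorm : ‖(alpha D : ℂ)⁻¹ * S‖ = (alpha D)⁻¹ * ‖S‖ := by
    rw [norm_mul, norm_inv, Complex.norm_real, Real.norm_eq_abs, abs_of_pos hα]
  rw [hnorm] at hαS
  calc ‖S‖ = alpha D * ((alpha D)⁻¹ * ‖S‖) := by field_simp
    _ ≤ alpha D * ((‖m‖ + 1) * frakA χ) := mul_le_mul_of_nonneg_left hαS hα.le

/-- **(S) ⇒ (E):** the three rows (S) give the error row `E(𝐚_u, conj 𝐚_u) = 𝔓𝓛²Σ|S_j| ≤ ε·𝔞𝔓` eventually —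
`Σ|S_j| ≤ α(Σ|𝔪_j| + 3)𝔞 = π(Σ|𝔪_j| + 3)𝓛⁻⁹𝔞`, so `E ≤ π(Σ|𝔪_j| + 3)·𝓛⁻⁷·𝔞𝔓`. (This is the unstated reason Prop.
7.1's `O(E)` is `o(𝔞𝔓)` for profile data.) [cite: Zhang2022LandauSiegel, §7 Prop 7.1, §8 p. 18] -/
theorem errRow_of_sjRows (h1 : SjProfileRow c' 1 u u') (h2 : SjProfileRow c' 2 u u') (h3 : SjProfileRow c' 3 u u') :
    ∀ ε : ℝ, 0 < ε → ForAllLarge fun D _ χ => AssumptionA D χ →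
      Ecal c' D (profTable u D χ) (fun n => conj (profTable u D χ n)) ≤ ε * (frakA χ * frakP D) := by
  intro ε hε
  obtain ⟨a₀, ha₀, hAlow⟩ := frakALowerBound_holds
  set M : ℝ := ‖sjProfileMain 1 u u'‖ + ‖sjProfileMain 2 u u'‖ + ‖sjProfileMain 3 u u'‖ with hM
  have hM0 : 0 ≤ M := by positivity
  -- threshold: `𝓛 ≥ 1` and `𝓛⁷ ≥ π(M+3)/ε`; use `𝓛 ≥ max 1 (π(M+3)/ε)` (then `𝓛⁷ ≥ 𝓛`)
  set L₀ : ℝ := max 1 (π * (M + 3) / ε) with hL₀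
  have hL : ForAllLarge fun D _ _ => L₀ ≤ ell D :=
    ForAllLarge.of_le ⌈Real.exp L₀⌉₊ fun D _ _ hD _ _ => le_ell_of_ceil_exp_le' hD
  refine (((((norm_Sj_le_of_row h1).and (norm_Sj_le_of_row h2)).and (norm_Sj_le_of_row h3)).and hAlow).and hL).mono ?_
  intro D _ χ _ _ hh hA
  obtain ⟨⟨⟨⟨b1, b2⟩, b3⟩, hAD⟩, hLD⟩ := hh
  replace b1 := b1 hA; replace b2 := b2 hA; replace b3 := b3 hA
  have hA0 : 0 ≤ frakA χ := ha₀.le.trans (hAD hA)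
  have hP0 : 0 ≤ frakP D := frakP_nonneg D
  have hL1 : 1 ≤ ell D := le_trans (le_max_left _ _) hLD
  have hL2 : π * (M + 3) / ε ≤ ell D := le_trans (le_max_right _ _) hLD
  have hℓ : 0 < ell D := by linarith
  have hsum : ‖Sj c' D 1 (profTable u D χ) (fun n => conj (profTable u D χ n))‖
      + ‖Sj c' D 2 (profTable u D χ) (fun n => conj (profTable u D χ n))‖
      + ‖Sj c' D 3 (profTable u D χ) (fun n => conj (profTable u D χ n))‖ ≤ alpha D * ((M + 3) * frakA χ) := by
    calc _ ≤ alpha D * ((‖sjProfileMain 1 u u'‖ + 1) * frakA χ) + alpha D * ((‖sjProfileMain 2 u u'‖ + 1) * frakA χ)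
          + alpha D * ((‖sjProfileMain 3 u u'‖ + 1) * frakA χ) := add_le_add (add_le_add b1 b2) b3
      _ = alpha D * ((M + 3) * frakA χ) := by rw [hM]; ring
  unfold Ecal
  have h7 : ell D ^ 2 * alpha D * (M + 3) ≤ ε := by
    rw [alpha_eq]
    have h9 : ell D ^ 9 = ell D ^ 2 * ell D ^ 7 := by ring
    rw [h9]
    have h77 : ell D ≤ ell D ^ 7 := by
      calc ell D = ell D ^ 1 := (pow_one _).symm
        _ ≤ ell D ^ 7 := pow_le_pow_right₀ hL1 (by norm_num)
    have hden : 0 < ell D ^ 2 * ell D ^ 7 := by positivity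
    have hstep : π * (M + 3) ≤ ε * ell D := by
      have := (div_le_iff₀ hε).mp hL2
      linarith
    calc ell D ^ 2 * (π / (ell D ^ 2 * ell D ^ 7)) * (M + 3) = π * (M + 3) / ell D ^ 7 := by
          field_simp
      _ ≤ ε * ell D / ell D ^ 7 := by gcongr
      _ ≤ ε * ell D ^ 7 / ell D ^ 7 := by gcongr
      _ = ε := by field_simp
  calc frakP D * ell D ^ 2 * (‖Sj c' D 1 (profTable u D χ) (fun n => conj (profTable u D χ n))‖
        + ‖Sj c' D 2 (profTable u D χ) (fun n => conj (profTable u D χ n))‖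
        + ‖Sj c' D 3 (profTable u D χ) (fun n => conj (profTable u D χ n))‖)
      ≤ frakP D * ell D ^ 2 * (alpha D * ((M + 3) * frakA χ)) := by gcongr
    _ = (ell D ^ 2 * alpha D * (M + 3)) * (frakA χ * frakP D) := by ring
    _ ≤ ε * (frakA χ * frakP D) := mul_le_mul_of_nonneg_right h7 (mul_nonneg hA0 hP0)

end MainAndError

/-! ### Part 5 — the reduction: rows (S) ⇒ the repaired K0 on short pieces -/

section Reduction

variable {c' : ℝ}

/-- **K0 ON A SHORT IN-CLASS PIECE FROM ITS THREE §8 ROWS (S):** for every sufficiently large `c′` (the tree's threshold of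
`discMean_apoly_of_meanValue_closed'`: Lemma 8.1, Prop. 2.2 (i), Lemma 2.3 eventually; Prop. 7.1 at every `c′`), an
in-class piece `u` vanishing from `θ < 1` on whose profile table satisfies the rows (S) for `j = 1, 2, 3` has Zhang's
side-table asymptotic `Ξ(H_u) = 𝔅(u)·𝔞𝔓 + o(𝔞𝔓)` under (A). [cite: Zhang2022LandauSiegel, §7 Prop 7.1, §8 Lemma 8.1, (8.23)] -/
theorem inClassMean_short_of_sjRows :
    ∃ c₀ : ℝ, 0 ≤ c₀ ∧ ∀ c' : ℝ, c₀ ≤ c' → ∀ (u u' : ℝ → ℂ) (θ : ℝ), InClassPiece u u' → θ < 1 →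
      (∀ y : ℝ, θ ≤ y → u y = 0) → SjProfileRow c' 1 u u' → SjProfileRow c' 2 u u' → SjProfileRow c' 3 u u' →
      ∀ ε : ℝ, 0 < ε → ForAllLarge fun D _ χ => AssumptionA D χ →
        |discMean c' χ (fun x t => profPoly χ x u (⌊bigP D⌋₊ + 1) t) - mainTermForm u u' * frakA χ * frakP D|
          ≤ ε * frakA χ * frakP D := by
  obtain ⟨c₀, hc0, h⟩ := discMean_apoly_of_meanValue_closed'
  refine ⟨c₀, hc0, fun c' hc' u u' θ hu hθ hvan h1 h2 h3 ε hε => ?_⟩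
  obtain ⟨B, hB0, hB⟩ := hu.exists_bound
  have hmean := h c' hc' (a := profTable u) (B := B) (m := mainTermForm u u')
    (fun D χ => adm72_profTable hB0 hB D χ) (mainRow_of_sjRows hu h1 h2 h3) (errRow_of_sjRows h1 h2 h3) ε hε
  refine (hmean.and (apoly_profTable_eq_profPoly hθ hvan)).mono ?_
  intro D _ χ _ _ hh hA
  obtain ⟨hm, heq⟩ := hh
  have hfun : (fun (x : Chr D) (s : ℂ) => Apoly x (profTable u D χ) s)
      = fun x t => profPoly χ x u (⌊bigP D⌋₊ + 1) t := by
    funext x s; exact heq x s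
  rw [← hfun]
  exact hm hA

/-- **Packaged:** for every sufficiently large `c′`, the rows (S) on ALL short in-class pieces give `InClassMeanShort c′`.
[cite: Zhang2022LandauSiegel, §7 Prop 7.1, §8 Lemma 8.1, (8.23)] -/
theorem inClassMeanShort_of_sjRows :
    ∃ c₀ : ℝ, 0 ≤ c₀ ∧ ∀ c' : ℝ, c₀ ≤ c' →
      (∀ (u u' : ℝ → ℂ) (θ : ℝ), InClassPiece u u' → θ < 1 → (∀ y : ℝ, θ ≤ y → u y = 0) →
        SjProfileRow c' 1 u u' ∧ SjProfileRow c' 2 u u' ∧ SjProfileRow c' 3 u u') →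
      InClassMeanShort c' := by
  obtain ⟨c₀, hc0, h⟩ := inClassMean_short_of_sjRows
  refine ⟨c₀, hc0, fun c' hc' hrows u u' θ hu hθ hvan => ?_⟩
  obtain ⟨h1, h2, h3⟩ := hrows u u' θ hu hθ hvan
  exact h c' hc' u u' θ hu hθ hvan h1 h2 h3

end Reduction

end KnifeEdge

end Literature.NumberTheory.LFunctions.Zhang2022

end
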